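/-
Copyright (c) 2026 the pub-hodgecm-mathlib formalisation cell (harness21).  Prover seat hodgecm-mathlib-K2E1-p13 (g3), Track B ∕ K2-LIT, h413 = `stmt-HodgeConjecture-24833`,
line `K2_E1_TraceFormulaBeta`, route of record `HCCMUnconditional`; dealer K2E1-plan (g7) deals (245)–(247): the (d)-REALNESS letter `hreal` (and the entry letter `hs`) for the M1
scattering coordinates — the ASSEMBLY over ★ `K2E1ChiMaassSelbergContinuedOnBoxesCMTwo` (self-dual inner-product model, general boxes), ★ `K2E1ChiEisensteinNoComplexPoleCMTwo`
(box ⇒ punctured bound, Riemann brick), ★ `K2E1MeromorphicStripFinitePoles` §4 (`hs`) and the reflection `conj` (★ `K2E1ChiScatteringConjSymmetryM1CMTwo` pays it at M1).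
-/
import Summits.HodgeConjecture.HodgeConjecture.Theorems.K2E1ChiEisensteinNoComplexPoleCMTwo        -- ★ p860014 (K2E1-p15): `exists_eventually_le_of_boxBound`, `analyticAt_of_sq_le_bracket`; brings ★ OnBoxes, ★ Models, ★ (L4), ★ `countable_of_codiscreteWithin`, ★ `isPreconnected_convex_diff_of_countable`
import Summits.HodgeConjecture.HodgeConjecture.Theorems.K2E1MeromorphicStripFinitePoles             -- ★ p860392 (K2E1-p14): `exists_finset_differentiableOn_halfStrip_of_fe_of_conj` (the `hs` package); brings ★ p860080 and ★ `eventually_one_sub_notMem_and_conj_notMem`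
import HarnessLib

/-!
# K2·E1 — `K2E1ChiScatteringRealPolesM1CMTwo`: THE (d)-REALNESS LETTER `hreal` AND THE ENTRY LETTER `hs` FOR THE SCATTERING COORDINATES `qc_j` OF A SELF-DUAL DATUM —
# «IN `½ < Re z` THE CONTINUED SCATTERING COORDINATES HAVE NO POLE OFF THE REAL AXIS», hypothesis-first on the self-dual Maass–Selberg MODEL data per ball (the bytes of ★
# `poleControl_continued_chi_cm_two_of_family_selfDual_on`) and on the reflection symmetry `qc_j(conj z) = conj qc_j(z)` (★ p860445 at M1)

Track B ∕ K2-LIT, crux h413 = `stmt-HodgeConjecture-24833`; cell `hodgecm-mathlib`, squad K2, ENGINE E1, campaign «5Res», road «BL-2(χ,τ) ∘ MS-2(χ,τ) ∘ ARCH-UNITARITY ∘ R8₂»,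
(d)-block.  THEOREMS ONLY (no `def`, no `instance`, no notation, no named-fact hypothesis, no `sorry`; default heartbeats); lane `--kind proof --supports stmt-HodgeConjecture-24833
--as helper` (count-neutral).  Closes no socket.  NO automorphic object: complex analysis and Hilbert-space calculus on the letters.

THE MATHEMATICS ([MoeglinWaldspurger1995, IV.1.9, IV.1.11, IV.3.12 (a)]; [BernsteinLapid2019, Thm 2.3, §4]; [Langlands1976, §7]).  Let `qc_j : ℂ → ℂ` (`j ∈ ι′`) be the scattering
coordinates of the continued intertwined section `ψ(z) = M(z, χ)φ = r·Σ_j qc_j(z)·e_j` of a section `φ ≠ 0` against a linearly independent family `e_j` of a complex inner-product space `V`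
(the M1 print ★ p860338: `qc_j` meromorphic in normal form on `ℂ`, analytic off ONE closed co-discrete `P ⊆ {Re ≤ 1}`).  Suppose that on the per-ball upper domains
`D₁(n) = ({½ < Re, 0 < Im} ∩ D_n ∩ U_n) ∖ P` (`D_n = ball 0 (n+2)`, `U_n` open and co-discrete in `D_n` — the bytes of ★ `exists_truncatedFamily_chi_cm_two_upper`) the SELF-DUAL
MAASS–SELBERG MODEL RELATION holds: a holomorphic `F_n : D₁(n) → H` into a complex inner-product space with `⟪F_n z′, F_n z⟫ = cμ_n·K_n·(four brackets `κm⟪φ,φ⟫, κm⟪ψ z′,φ⟫, κm⟪φ,ψ z⟫,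
κm⟪ψ z′,ψ z⟫` with base `T_n`)` on the sub-tube `1 < Re z′ < Re z` (VERBATIM the `hrel` bytes of ★ `poleControl_continued_chi_cm_two_of_family_selfDual_on`).  THEN every `qc_j` is
ANALYTIC at every `z₁` with `½ < Re z₁`, `0 < Im z₁`: [MW] IV.3.12 (a) bounds `b(z) = κm‖ψ z‖²` in boxes (★ OnBoxes `poleControl_continued_chi_cm_two_of_family_on'`, self-dual letters
paid by ★ Models §1), `D₁(n)` contains a punctured neighbourhood of `z₁` for `n` large (co-discreteness of `U_n` and `P`), so `b` is bounded near `z₁` (★ `exists_eventually_le_of_boxBound`);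
coordinates against a linearly independent finite family are norm-dominated (`‖qc_j(z)‖ ≤ C‖ψ z‖`, finite-dimensional inverse), so the Riemann brick ★ `analyticAt_of_sq_le_bracket` removes
the putative pole.  The LOWER half-plane follows by the reflection symmetry `qc_j(conj z) = conj qc_j(z)` off `P ∪ conj P` (at M1: ★ p860445 `chi_scattering_conj_symm_m1_cm_two`): near
`z₁` with `Im z₁ < 0`, `qc_j` agrees on a punctured neighbourhood with the continuous `z ↦ conj qc_j(conj z)`, hence is bounded, hence analytic (★ (L4)).  So every genuine pole of `qc_j`
in `½ < Re z ≤ σ₀` (`σ₀ > 1`) is REAL and `< σ₀` — the letter `hreal` of ★ `exists_finset_differentiableOn_halfStrip_of_fe_of_conj`, which with (FE) `qc_j(z)qc_j(1 − z) = 1` (★ C3,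
self-dual) returns the entry letter `hs` (finitely many real poles `S ⊂ (½, σ₀)`, `qc_j` holomorphic on an open `U ⊇ {½ ≤ Re ≤ σ₀}` off `S`).

* §1 (pure) `exists_norm_apply_le_norm_sum_smul` (coordinate domination), `poleControl_continued_chi_cm_two_of_family_selfDual_on'` (the self-dual model, GENERAL BOXES — ★ Models §2
  re-run through ★ OnBoxes), `analyticAt_of_eventuallyEq_conj` + `eventually_eq_conj_of_poleSet` (lower half-plane by reflection).
* §2 (pure, one domain) **`analyticAt_of_family_selfDual_on'`** — a `ψ`-dominated normal-form scalar piece is analytic at every `z₁ ∈ D⁺` punctured-near which `D₁` lies.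
* §3 (pure, the ball domains) `upperBallDomain_topology` (the topology block of ★ `chiPoleExclusion_bounds_cm_two`, exported), `eventually_mem_upperBallDomain`, `mem_ball_max_ceil`.
* §4 ONE `variable` block of per-ball letters (the payers' interface, stated once) and THE HEADS: **`analyticAt_coords_of_family_selfDual_balls`** (`∀ j, ∀ z₁ ∈ D⁺, AnalyticAt ℂ (qc j) z₁`),
  **`chi_scattering_noComplexPole_m1_cm_two`** (both half-planes, `+ hconj`), **`chi_scattering_hreal_m1_cm_two`** (`hreal` — ★ p860392 §4's binder VERBATIM, every `σ₀ > 1`; `+ hPre hconj`)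
  and **`chi_scattering_hs_m1_cm_two`** (`hreal ∧ hs`, `+ hPre hFE hconj`).
HONEST LABEL: HC_CM is proved only modulo the 7 printed citations (2 remaining named inputs: hLiu418 = `stmt-HodgeConjecture-24832`, h413 = `stmt-HodgeConjecture-24833`) until rung 0
closes; this file asserts no named fact, is conditional by construction on its binders (the per-ball model data `F hFd hrel`, the representation `hψ`, `hconj`, `hFE`), and closes no socket.

## References
* [MoeglinWaldspurger1995] C. Mœglin, J.-L. Waldspurger, *Spectral decomposition and Eisenstein series* (1995), IV.1.9, IV.1.11, IV.3.12 (a).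
* [BernsteinLapid2019] J. Bernstein, E. Lapid, *On the meromorphic continuation of Eisenstein series*, J. AMS 37 (2024), Thm 2.3, §4.
* [Langlands1976] R. P. Langlands, *On the Functional Equations Satisfied by Eisenstein Series*, LNM 544 (1976), §7.
* [Rudin1987] W. Rudin, *Real and Complex Analysis* (3rd ed., 1987), Thm. 10.20 (Riemann's removable singularity theorem), Thm. 11.14 (reflection).
-/

set_option autoImplicit false
set_option linter.dupNamespace false  -- the mandated namespace repeats the summit's segment (`HodgeConjecture.HodgeConjecture`)

noncomputable section

open Set Filter Topology
open scoped ComplexConjugate InnerProductSpace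
open Summit.HodgeConjecture.HodgeConjecture.Cruxes.H413.K2E1ChiMaassSelbergContinuedModelsCMTwo (real_mul_inner_self differentiableOn_inner_conj_comp norm_sq_real_mul_inner_le)
open Summit.HodgeConjecture.HodgeConjecture.Cruxes.H413.K2E1ChiMaassSelbergContinuedOnBoxesCMTwo (poleControl_continued_chi_cm_two_of_family_on')
open Summit.HodgeConjecture.HodgeConjecture.Cruxes.H413.K2E1ChiEisensteinNoComplexPoleCMTwo (exists_eventually_le_of_boxBound analyticAt_of_sq_le_bracket)
open Summit.HodgeConjecture.HodgeConjecture.Cruxes.H413.K2E1ConvexDiffCountableConnected (isPreconnected_convex_diff_of_countable)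
open Summit.HodgeConjecture.HodgeConjecture.Cruxes.H413.K2E1SphericalEisensteinPoleExclusionCMThree (countable_of_codiscreteWithin countable_ball_diff_of_codiscrete)
open Summit.HodgeConjecture.HodgeConjecture.Cruxes.H413.K2E1ScalarUnitaryAxisContinuationCMTwo (eventually_one_sub_notMem_and_conj_notMem)
open Summit.HodgeConjecture.HodgeConjecture.Cruxes.H413.K2E1MeromorphicStripFinitePoles (exists_finset_differentiableOn_halfStrip_of_fe_of_conj)

namespace Summit.HodgeConjecture.HodgeConjecture.Cruxes.H413.K2E1ChiScatteringRealPolesM1CMTwo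

/-! ## §1 Pure preliminaries: coordinate domination, the self-dual model with general boxes, reflection -/

section Prelim

variable {V : Type*} [NormedAddCommGroup V] [InnerProductSpace ℂ V]

/-- **COORDINATES AGAINST A LINEARLY INDEPENDENT FINITE FAMILY ARE NORM-DOMINATED**: `∃ C ≥ 0, ‖c_j‖ ≤ C·‖Σ_i c_i•e_i‖` for all coefficient vectors `c` (the inverse of the injective
linear map `c ↦ Σ c_i•e_i` out of the finite-dimensional `ι′ → ℂ` is continuous). [folklore] -/
theorem exists_norm_apply_le_norm_sum_smul {ι' : Type*} [Fintype ι'] {e : ι' → V} (he : LinearIndependent ℂ e) :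
    ∃ C : ℝ, 0 ≤ C ∧ ∀ (c : ι' → ℂ) (j : ι'), ‖c j‖ ≤ C * ‖∑ i, c i • e i‖ := by
  classical
  set Φ : (ι' → ℂ) →ₗ[ℂ] V := Fintype.linearCombination ℂ e with hΦdef
  have hΦ : ∀ c : ι' → ℂ, Φ c = ∑ i, c i • e i := fun c => Fintype.linearCombination_apply (R := ℂ) e c
  have hinj : Function.Injective Φ := he.fintypeLinearCombination_injective
  set Ψ : (ι' → ℂ) ≃L[ℂ] ↥(LinearMap.range Φ) := (LinearEquiv.ofInjective Φ hinj).toContinuousLinearEquiv with hΨdef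
  refine ⟨‖(Ψ.symm : ↥(LinearMap.range Φ) →L[ℂ] (ι' → ℂ))‖, ContinuousLinearMap.opNorm_nonneg _, fun c j => ?_⟩
  have h1 : Ψ.symm (Ψ c) = c := Ψ.symm_apply_apply c
  have h2 : ‖c‖ ≤ ‖(Ψ.symm : ↥(LinearMap.range Φ) →L[ℂ] (ι' → ℂ))‖ * ‖Ψ c‖ := by
    conv_lhs => rw [← h1]
    exact (Ψ.symm : ↥(LinearMap.range Φ) →L[ℂ] (ι' → ℂ)).le_opNorm (Ψ c)
  have h3 : ‖Ψ c‖ = ‖∑ i, c i • e i‖ := by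
    rw [← hΦ c]
    show ‖((Ψ c : ↥(LinearMap.range Φ)) : V)‖ = ‖Φ c‖
    rw [hΨdef, LinearEquiv.coe_toContinuousLinearEquiv', LinearEquiv.ofInjective_apply]
  calc ‖c j‖ ≤ ‖c‖ := norm_le_pi_norm c j
    _ ≤ ‖(Ψ.symm : ↥(LinearMap.range Φ) →L[ℂ] (ι' → ℂ))‖ * ‖Ψ c‖ := h2
    _ = ‖(Ψ.symm : ↥(LinearMap.range Φ) →L[ℂ] (ι' → ℂ))‖ * ‖∑ i, c i • e i‖ := by rw [h3]

/-- **THE SELF-DUAL MODEL (`χ = χʷ`), GENERAL-BOX EDITION** — ★ `poleControl_continued_chi_cm_two_of_family_selfDual_on` with the sub-tube boxes as DATA (`O₁, O₂' ⊆ D₁` open non-empty,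
`1 < Re z′ < Re z` across; VERBATIM the binders of ★ `poleControl_continued_chi_cm_two_of_family_on'`): one complex inner-product space `V`, `φ ∈ V ∖ 0`, `ψ : ℂ → V` holomorphic on `D₁`,
`κ, m > 0`, `F : ℂ → H` holomorphic on `D₁` with the four-bracket relation for `κm⟪φ,φ⟫, κm⟪ψ z′,φ⟫, κm⟪φ,ψ z⟫, κm⟪ψ z′,ψ z⟫` on the sub-tube.  THEN (a1)∧(a2)∧(a3) with `a = κm‖φ‖²`,
`b(z) = κm‖ψ z‖²` at every `z ∈ D₁` (bracket letters paid by ★ Models §1). [cite: MoeglinWaldspurger1995, IV.2.3, IV.3.12 (a)] -/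
theorem poleControl_continued_chi_cm_two_of_family_selfDual_on' {D₁ : Set ℂ} (hD₁ : IsOpen D₁) (hD₁c : IsPreconnected D₁) (hD₁sub : D₁ ⊆ {z : ℂ | 1 / 2 < z.re ∧ 0 < z.im})
    {O₁ O₂' : Set ℂ} (hO₁ : IsOpen O₁) (hO₁ne : O₁.Nonempty) (hO₁D : O₁ ⊆ D₁) (hO₂' : IsOpen O₂') (hO₂'ne : O₂'.Nonempty) (hO₂'D : O₂' ⊆ D₁)
    (hsep : ∀ z ∈ O₁, ∀ z' ∈ O₂', 1 < z'.re ∧ z'.re < z.re)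
    {T cμ K κ m : ℝ} (hT : 1 ≤ T) (hcμ : 0 < cμ) (hK : 0 < K) (hκ : 0 < κ) (hm : 0 < m) {φ : V} (hφ : φ ≠ 0) {ψ : ℂ → V} (hψ : DifferentiableOn ℂ ψ D₁)
    {H : Type*} [NormedAddCommGroup H] [InnerProductSpace ℂ H] (F : ℂ → H) (hFd : DifferentiableOn ℂ F D₁)
    (hrel : ∀ z ∈ D₁, ∀ z' ∈ D₁, 1 < z'.re → z'.re < z.re →
      ⟪F z', F z⟫_ℂ = ((cμ : ℝ) : ℂ) * (((K : ℝ) : ℂ) *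
        ((((T : ℝ) : ℂ) ^ (z + conj z' - 1) / (z + conj z' - 1)) * (((κ : ℝ) : ℂ) * (((m : ℝ) : ℂ) * ⟪φ, φ⟫_ℂ))
          + (((T : ℝ) : ℂ) ^ (z - conj z') / (z - conj z')) * (((κ : ℝ) : ℂ) * (((m : ℝ) : ℂ) * ⟪ψ z', φ⟫_ℂ))
          - (((T : ℝ) : ℂ) ^ (-(z - conj z')) / (z - conj z')) * (((κ : ℝ) : ℂ) * (((m : ℝ) : ℂ) * ⟪φ, ψ z⟫_ℂ))
          - (((T : ℝ) : ℂ) ^ (-(z + conj z' - 1)) / (z + conj z' - 1)) * (((κ : ℝ) : ℂ) * (((m : ℝ) : ℂ) * ⟪ψ z', ψ z⟫_ℂ)))))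
    {z : ℂ} (hz : z ∈ D₁) :
    Real.sqrt (κ * m * ‖ψ z‖ ^ 2) ≤ (z.re - 1 / 2) * T ^ (2 * (z.re - 1 / 2)) * Real.sqrt (κ * m * ‖φ‖ ^ 2) / |z.im| +
        Real.sqrt ((z.re - 1 / 2) ^ 2 * T ^ (4 * (z.re - 1 / 2)) * (κ * m * ‖φ‖ ^ 2) / z.im ^ 2 + (κ * m * ‖φ‖ ^ 2) * T ^ (4 * (z.re - 1 / 2))) ∧
      (∀ {x₁ x₂ η : ℝ}, 0 < x₁ → (z.re - 1 / 2) ∈ Set.Icc x₁ x₂ → 0 < η → η ≤ |z.im| →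
        κ * m * ‖ψ z‖ ^ 2 ≤ (x₂ * T ^ (2 * x₂) * Real.sqrt (κ * m * ‖φ‖ ^ 2) / η + Real.sqrt (x₂ ^ 2 * T ^ (4 * x₂) * (κ * m * ‖φ‖ ^ 2) / η ^ 2 + (κ * m * ‖φ‖ ^ 2) * T ^ (4 * x₂))) ^ 2) ∧
      (|z.im| ≤ 1 → κ * m * ‖ψ z‖ ^ 2 ≤ ((z.re - 1 / 2) * T ^ (2 * (z.re - 1 / 2)) * Real.sqrt (κ * m * ‖φ‖ ^ 2) +
        Real.sqrt ((z.re - 1 / 2) ^ 2 * T ^ (4 * (z.re - 1 / 2)) * (κ * m * ‖φ‖ ^ 2) + (κ * m * ‖φ‖ ^ 2) * T ^ (4 * (z.re - 1 / 2)))) ^ 2 / z.im ^ 2) := by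
  have hφn : 0 < ‖φ‖ := norm_pos_iff.2 hφ
  have ha : 0 < κ * m * ‖φ‖ ^ 2 := by positivity
  have hB₂ : DifferentiableOn ℂ (fun w : ℂ => ((κ : ℝ) : ℂ) * (((m : ℝ) : ℂ) * ⟪ψ (conj w), φ⟫_ℂ)) {w : ℂ | conj w ∈ D₁} :=
    ((differentiableOn_inner_conj_comp hD₁ hψ φ).const_mul _).const_mul _
  have hB₃ : DifferentiableOn ℂ (fun z : ℂ => ((κ : ℝ) : ℂ) * (((m : ℝ) : ℂ) * ⟪φ, ψ z⟫_ℂ)) D₁ :=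
    (((innerSL ℂ φ).differentiable.comp_differentiableOn hψ).const_mul _).const_mul _
  have hB₃₂ : ∀ z ∈ D₁, ((κ : ℝ) : ℂ) * (((m : ℝ) : ℂ) * ⟪φ, ψ z⟫_ℂ) = conj (((κ : ℝ) : ℂ) * (((m : ℝ) : ℂ) * ⟪ψ z, φ⟫_ℂ)) := fun z _ => by
    rw [map_mul, map_mul, Complex.conj_ofReal, Complex.conj_ofReal, inner_conj_symm]
  have hB₄₁ : ∀ z' ∈ D₁, DifferentiableOn ℂ (fun z : ℂ => ((κ : ℝ) : ℂ) * (((m : ℝ) : ℂ) * ⟪ψ z', ψ z⟫_ℂ)) D₁ := fun z' _ =>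
    (((innerSL ℂ (ψ z')).differentiable.comp_differentiableOn hψ).const_mul _).const_mul _
  have hB₄₂ : ∀ z ∈ D₁, DifferentiableOn ℂ (fun w : ℂ => ((κ : ℝ) : ℂ) * (((m : ℝ) : ℂ) * ⟪ψ (conj w), ψ z⟫_ℂ)) {w : ℂ | conj w ∈ D₁} := fun z _ =>
    ((differentiableOn_inner_conj_comp hD₁ hψ (ψ z)).const_mul _).const_mul _
  exact poleControl_continued_chi_cm_two_of_family_on' hD₁ hD₁c hD₁sub hO₁ hO₁ne hO₁D hO₂' hO₂'ne hO₂'D hsep hT hcμ hK ha (b := fun z => κ * m * ‖ψ z‖ ^ 2)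
    (fun z _ => by positivity)
    (B₁ := ((κ : ℝ) : ℂ) * (((m : ℝ) : ℂ) * ⟪φ, φ⟫_ℂ)) (B₂ := fun z' => ((κ : ℝ) : ℂ) * (((m : ℝ) : ℂ) * ⟪ψ z', φ⟫_ℂ))
    (B₃ := fun z => ((κ : ℝ) : ℂ) * (((m : ℝ) : ℂ) * ⟪φ, ψ z⟫_ℂ)) (B₄ := fun z z' => ((κ : ℝ) : ℂ) * (((m : ℝ) : ℂ) * ⟪ψ z', ψ z⟫_ℂ))
    (real_mul_inner_self κ m φ) hB₂ hB₃ hB₃₂ hB₄₁ hB₄₂ (fun z _ => real_mul_inner_self κ m (ψ z)) (fun z _ => norm_sq_real_mul_inner_le hκ.le hm.le (ψ z) φ) F hFd hrel hz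

/-- **REFLECTION: a normal-form scalar that equals `conj q(conj ·)` on a punctured neighbourhood of `z₁` and is analytic at `conj z₁` is analytic at `z₁`** — `z ↦ conj q(conj z)` is
continuous at `z₁`, so `q` is bounded on `𝓝[≠] z₁`; Riemann's brick in normal form (★ (L4) `MeromorphicNFAt.analyticAt_of_eventually_norm_le`). [cite: Rudin1987, Thm. 10.20 and Thm. 11.14] -/
theorem analyticAt_of_eventuallyEq_conj {q : ℂ → ℂ} {z₁ : ℂ} (hq : MeromorphicNFAt q z₁) (han : AnalyticAt ℂ q (conj z₁))
    (hsymm : ∀ᶠ z in 𝓝[≠] z₁, q z = conj (q (conj z))) : AnalyticAt ℂ q z₁ := by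
  have hg : ContinuousAt (fun z : ℂ => conj (q (conj z))) z₁ :=
    Complex.continuous_conj.continuousAt.comp (ContinuousAt.comp (f := fun z : ℂ => conj z) han.continuousAt Complex.continuous_conj.continuousAt)
  have hbd : ∀ᶠ z in 𝓝 z₁, ‖conj (q (conj z))‖ < ‖conj (q (conj z₁))‖ + 1 := hg.norm.eventually_lt_const (lt_add_one _)
  refine hq.analyticAt_of_eventually_norm_le ⟨‖conj (q (conj z₁))‖ + 1, ?_⟩
  filter_upwards [hsymm, mem_nhdsWithin_of_mem_nhds hbd] with z hz hzb
  rw [hz]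
  exact hzb.le

/-- **`q = conj q(conj ·)` PUNCTURED-NEAR EVERY POINT**, from the reflection symmetry `q(conj z) = conj q(z)` off `P ∪ conj P` with `P` co-discrete (★ `eventually_one_sub_notMem_and_conj_notMem`).
[cite: Langlands1976, §7] -/
theorem eventually_eq_conj_of_poleSet {P : Set ℂ} (hPcd : ∀ z₀ : ℂ, ∀ᶠ w in 𝓝[≠] z₀, w ∉ P) {q : ℂ → ℂ}
    (hconj : ∀ z : ℂ, z ∉ P → conj z ∉ P → q (conj z) = conj (q z)) (z₁ : ℂ) :
    ∀ᶠ z in 𝓝[≠] z₁, q z = conj (q (conj z)) := by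
  filter_upwards [hPcd z₁, eventually_one_sub_notMem_and_conj_notMem hPcd z₁] with z hzP hz
  have h := hconj (conj z) hz.2 (by rwa [Complex.conj_conj])
  rw [Complex.conj_conj] at h
  exact h

end Prelim

/-! ## §2 One domain: a `ψ`-dominated normal-form scalar piece is analytic at every `z₁ ∈ D⁺` punctured-near which `D₁` lies -/

section OneDomain

variable {V : Type*} [NormedAddCommGroup V] [InnerProductSpace ℂ V]

/-- **NO POLE OFF THE REAL AXIS FROM THE SELF-DUAL MODEL ON ONE DOMAIN.**  `D₁ ⊆ D⁺ = {½ < Re, 0 < Im}` open preconnected with two sub-tube boxes; the self-dual model data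
`(T, cμ, K, κ, m, φ, ψ, F, hrel)` VERBATIM as `poleControl_continued_chi_cm_two_of_family_selfDual_on'`; a scalar `q` meromorphic in normal form at `z₁ ∈ D⁺`, DOMINATED by `ψ` on `D₁`
(`‖q z‖ ≤ C‖ψ z‖` — a coordinate of `ψ`), and `D₁ ∈ 𝓝[≠] z₁`.  THEN `q` is ANALYTIC at `z₁`: (a2) boxes `b = κm‖ψ‖²` (★ OnBoxes), ★ `exists_eventually_le_of_boxBound`, ★
`analyticAt_of_sq_le_bracket` with `c₀ = C²∕(κm)`. [cite: MoeglinWaldspurger1995, IV.1.9, IV.3.12 (a)] [cite: BernsteinLapid2019, §4] -/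
theorem analyticAt_of_family_selfDual_on' {D₁ : Set ℂ} (hD₁ : IsOpen D₁) (hD₁c : IsPreconnected D₁) (hD₁sub : D₁ ⊆ {z : ℂ | 1 / 2 < z.re ∧ 0 < z.im})
    {O₁ O₂' : Set ℂ} (hO₁ : IsOpen O₁) (hO₁ne : O₁.Nonempty) (hO₁D : O₁ ⊆ D₁) (hO₂' : IsOpen O₂') (hO₂'ne : O₂'.Nonempty) (hO₂'D : O₂' ⊆ D₁)
    (hsep : ∀ z ∈ O₁, ∀ z' ∈ O₂', 1 < z'.re ∧ z'.re < z.re)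
    {T cμ K κ m : ℝ} (hT : 1 ≤ T) (hcμ : 0 < cμ) (hK : 0 < K) (hκ : 0 < κ) (hm : 0 < m) {φ : V} (hφ : φ ≠ 0) {ψ : ℂ → V} (hψ : DifferentiableOn ℂ ψ D₁)
    {H : Type*} [NormedAddCommGroup H] [InnerProductSpace ℂ H] (F : ℂ → H) (hFd : DifferentiableOn ℂ F D₁)
    (hrel : ∀ z ∈ D₁, ∀ z' ∈ D₁, 1 < z'.re → z'.re < z.re →
      ⟪F z', F z⟫_ℂ = ((cμ : ℝ) : ℂ) * (((K : ℝ) : ℂ) *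
        ((((T : ℝ) : ℂ) ^ (z + conj z' - 1) / (z + conj z' - 1)) * (((κ : ℝ) : ℂ) * (((m : ℝ) : ℂ) * ⟪φ, φ⟫_ℂ))
          + (((T : ℝ) : ℂ) ^ (z - conj z') / (z - conj z')) * (((κ : ℝ) : ℂ) * (((m : ℝ) : ℂ) * ⟪ψ z', φ⟫_ℂ))
          - (((T : ℝ) : ℂ) ^ (-(z - conj z')) / (z - conj z')) * (((κ : ℝ) : ℂ) * (((m : ℝ) : ℂ) * ⟪φ, ψ z⟫_ℂ))
          - (((T : ℝ) : ℂ) ^ (-(z + conj z' - 1)) / (z + conj z' - 1)) * (((κ : ℝ) : ℂ) * (((m : ℝ) : ℂ) * ⟪ψ z', ψ z⟫_ℂ)))))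
    {q : ℂ → ℂ} {C : ℝ} (hdom : ∀ z ∈ D₁, ‖q z‖ ≤ C * ‖ψ z‖)
    {z₁ : ℂ} (hq : MeromorphicNFAt q z₁) (hz₁ : 1 / 2 < z₁.re ∧ 0 < z₁.im) (hev : ∀ᶠ z in 𝓝[≠] z₁, z ∈ D₁) :
    AnalyticAt ℂ q z₁ := by
  have hκm : 0 < κ * m := mul_pos hκ hm
  -- (a2) on `D₁`, then the punctured-neighbourhood bound of `b = κm‖ψ‖²` near `z₁`
  have hbdd : ∃ C' : ℝ, ∀ᶠ z in 𝓝[≠] z₁, κ * m * ‖ψ z‖ ^ 2 ≤ C' :=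
    exists_eventually_le_of_boxBound (b := fun z => κ * m * ‖ψ z‖ ^ 2) (a := κ * m * ‖φ‖ ^ 2) (T := T)
      (fun z hz => (poleControl_continued_chi_cm_two_of_family_selfDual_on' hD₁ hD₁c hD₁sub hO₁ hO₁ne hO₁D hO₂' hO₂'ne hO₂'D hsep hT hcμ hK hκ hm hφ hψ F hFd hrel hz).2.1)
      hz₁ hev
  -- domination `‖q z‖² ≤ (C²∕κm)·b z` punctured-near `z₁`
  have hdom' : ∀ᶠ z in 𝓝[≠] z₁, ‖q z‖ ^ 2 ≤ C ^ 2 / (κ * m) * (κ * m * ‖ψ z‖ ^ 2) := by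
    filter_upwards [hev] with z hz
    have h1 : ‖q z‖ ^ 2 ≤ (C * ‖ψ z‖) ^ 2 := pow_le_pow_left₀ (norm_nonneg _) (hdom z hz) 2
    calc ‖q z‖ ^ 2 ≤ (C * ‖ψ z‖) ^ 2 := h1
      _ = C ^ 2 / (κ * m) * (κ * m * ‖ψ z‖ ^ 2) := by field_simp
  exact analyticAt_of_sq_le_bracket hq hdom' hbdd (div_nonneg (sq_nonneg C) hκm.le)

end OneDomain

/-! ## §3 The ball domains `D₁(n) = ({½ < Re, 0 < Im} ∩ D_n ∩ U) ∖ P` -/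

section Balls

/-- **TOPOLOGY OF THE UPPER BALL DOMAIN** `D₁ = ({½ < Re, 0 < Im} ∩ ball 0 (n+2) ∩ U) ∖ P` (`2 ≤ n`, `U` open co-discrete in the ball, `P` closed countable): open, preconnected
(`D₁ = C ∖ S`, `C` open convex, `S = (D_n ∖ U) ∪ P` countable — ★ `isPreconnected_convex_diff_of_countable`), inside `D⁺`, and containing two open non-empty sub-tube boxes `O₁ ⊆ {3 < Re < 4}`,
`O₂' ⊆ {1 < Re < 2}` (density of `Sᶜ`) — VERBATIM the topology block of ★ `chiPoleExclusion_bounds_cm_two`, exported. [cite: MoeglinWaldspurger1995, IV.3.12 (a)] -/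
theorem upperBallDomain_topology (n : ℕ) (hn : 2 ≤ n) {U : Set ℂ} (hUo : IsOpen U) (hUcod : ∀ z₀ ∈ Metric.ball (0 : ℂ) (n + 2), ∀ᶠ s in 𝓝[≠] z₀, s ∈ U)
    {P : Set ℂ} (hPc : IsClosed P) (hPcount : P.Countable) :
    IsOpen (({z : ℂ | 1 / 2 < z.re ∧ 0 < z.im} ∩ Metric.ball (0 : ℂ) (n + 2) ∩ U) \ P) ∧
      IsPreconnected (({z : ℂ | 1 / 2 < z.re ∧ 0 < z.im} ∩ Metric.ball (0 : ℂ) (n + 2) ∩ U) \ P) ∧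
      ({z : ℂ | 1 / 2 < z.re ∧ 0 < z.im} ∩ Metric.ball (0 : ℂ) (n + 2) ∩ U) \ P ⊆ {z : ℂ | 1 / 2 < z.re ∧ 0 < z.im} ∧
      ∃ O₁ O₂' : Set ℂ, IsOpen O₁ ∧ O₁.Nonempty ∧ O₁ ⊆ ({z : ℂ | 1 / 2 < z.re ∧ 0 < z.im} ∩ Metric.ball (0 : ℂ) (n + 2) ∩ U) \ P ∧
        IsOpen O₂' ∧ O₂'.Nonempty ∧ O₂' ⊆ ({z : ℂ | 1 / 2 < z.re ∧ 0 < z.im} ∩ Metric.ball (0 : ℂ) (n + 2) ∩ U) \ P ∧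
        ∀ z ∈ O₁, ∀ z' ∈ O₂', 1 < z'.re ∧ z'.re < z.re := by
  set D₁ : Set ℂ := ({z : ℂ | 1 / 2 < z.re ∧ 0 < z.im} ∩ Metric.ball (0 : ℂ) (n + 2) ∩ U) \ P with hD₁def
  set C : Set ℂ := {z : ℂ | 1 / 2 < z.re ∧ 0 < z.im} ∩ Metric.ball (0 : ℂ) (n + 2) with hCdef
  set S : Set ℂ := (Metric.ball (0 : ℂ) (n + 2) \ U) ∪ P with hSdef
  have hQo : IsOpen {z : ℂ | 1 / 2 < z.re ∧ 0 < z.im} := (isOpen_lt continuous_const Complex.continuous_re).inter (isOpen_lt continuous_const Complex.continuous_im)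
  have hCo : IsOpen C := hQo.inter Metric.isOpen_ball
  have hCc : Convex ℝ C := ((convex_halfSpace_re_gt (1 / 2)).inter (convex_halfSpace_im_gt 0)).inter (convex_ball (0 : ℂ) (n + 2))
  have hSc : S.Countable := (countable_ball_diff_of_codiscrete hUcod).union hPcount
  have hDCS : D₁ = C \ S := by
    ext z
    simp only [hD₁def, hCdef, hSdef, Set.mem_sdiff, Set.mem_inter_iff, Set.mem_union, not_or, not_and, not_not]
    constructor
    · rintro ⟨⟨⟨hq, hb⟩, hU⟩, hP⟩
      exact ⟨⟨hq, hb⟩, fun _ => hU, hP⟩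
    · rintro ⟨⟨hq, hb⟩, hU, hP⟩
      exact ⟨⟨⟨hq, hb⟩, hU hb⟩, hP⟩
  have hD₁o : IsOpen D₁ := (hCo.inter hUo).sdiff hPc
  have hD₁c : IsPreconnected D₁ := by
    rw [hDCS]
    exact isPreconnected_convex_diff_of_countable Literature.Topology.Euclidean.one_lt_rank_real_complex hCc hCo hSc
  have hD₁sub : D₁ ⊆ {z : ℂ | 1 / 2 < z.re ∧ 0 < z.im} := fun z hz => hz.1.1.1
  have hn' : (2 : ℝ) ≤ n := by exact_mod_cast hn
  have hdense : Dense Sᶜ := hSc.dense_compl ℝ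
  have hbox : ∀ (a₁ b₁ : ℝ) (w : ℂ), a₁ < w.re → w.re < b₁ → 0 < w.im → w.im < 1 → 1 / 2 < w.re → ‖w‖ < n + 2 →
      IsOpen (D₁ ∩ {z : ℂ | (a₁ < z.re ∧ z.re < b₁) ∧ (0 < z.im ∧ z.im < 1)}) ∧ (D₁ ∩ {z : ℂ | (a₁ < z.re ∧ z.re < b₁) ∧ (0 < z.im ∧ z.im < 1)}).Nonempty := by
    intro a₁ b₁ w h1 h2 h3 h4 h5 h6
    have hBo : IsOpen {z : ℂ | (a₁ < z.re ∧ z.re < b₁) ∧ (0 < z.im ∧ z.im < 1)} :=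
      ((isOpen_lt continuous_const Complex.continuous_re).inter (isOpen_lt Complex.continuous_re continuous_const)).inter
        ((isOpen_lt continuous_const Complex.continuous_im).inter (isOpen_lt Complex.continuous_im continuous_const))
    refine ⟨hD₁o.inter hBo, ?_⟩
    have hwC : w ∈ C ∩ {z : ℂ | (a₁ < z.re ∧ z.re < b₁) ∧ (0 < z.im ∧ z.im < 1)} := ⟨⟨⟨h5, h3⟩, mem_ball_zero_iff.2 h6⟩, ⟨h1, h2⟩, ⟨h3, h4⟩⟩
    obtain ⟨z, ⟨hzC, hzB⟩, hzS⟩ := hdense.inter_open_nonempty _ (hCo.inter hBo) ⟨w, hwC⟩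
    refine ⟨z, ⟨?_, hzB⟩⟩
    rw [hDCS]
    exact ⟨hzC, hzS⟩
  have hw₁ : ‖(⟨31 / 10, 1 / 10⟩ : ℂ)‖ < n + 2 :=
    lt_of_le_of_lt (Complex.norm_le_abs_re_add_abs_im _) (by norm_num [abs_of_pos]; linarith)
  have hw₂ : ‖(⟨11 / 10, 1 / 10⟩ : ℂ)‖ < n + 2 :=
    lt_of_le_of_lt (Complex.norm_le_abs_re_add_abs_im _) (by norm_num [abs_of_pos]; linarith)
  obtain ⟨hO₁o, hO₁ne⟩ := hbox 3 4 ⟨31 / 10, 1 / 10⟩ (by norm_num) (by norm_num) (by norm_num) (by norm_num) (by norm_num) hw₁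
  obtain ⟨hO₂o, hO₂ne⟩ := hbox 1 2 ⟨11 / 10, 1 / 10⟩ (by norm_num) (by norm_num) (by norm_num) (by norm_num) (by norm_num) hw₂
  have hsep : ∀ z ∈ D₁ ∩ {z : ℂ | (3 < z.re ∧ z.re < 4) ∧ (0 < z.im ∧ z.im < 1)}, ∀ z' ∈ D₁ ∩ {z : ℂ | (1 < z.re ∧ z.re < 2) ∧ (0 < z.im ∧ z.im < 1)}, 1 < z'.re ∧ z'.re < z.re :=
    fun z hz z' hz' => ⟨hz'.2.1.1, by linarith [hz'.2.1.2, hz.2.1.1]⟩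
  exact ⟨hD₁o, hD₁c, hD₁sub, _, _, hO₁o, hO₁ne, Set.inter_subset_left, hO₂o, hO₂ne, Set.inter_subset_left, hsep⟩

/-- **THE UPPER BALL DOMAIN CONTAINS A PUNCTURED NEIGHBOURHOOD OF EVERY `z₁ ∈ D⁺ ∩ D_n`** (pole or not): `{½ < Re, 0 < Im} ∩ ball` is an open neighbourhood, `U` and `Pᶜ` are
punctured-neighbourhood-large (co-discreteness). [cite: BernsteinLapid2019, Thm 2.3] -/
theorem eventually_mem_upperBallDomain (n : ℕ) {U : Set ℂ} (hUcod : ∀ z₀ ∈ Metric.ball (0 : ℂ) (n + 2), ∀ᶠ s in 𝓝[≠] z₀, s ∈ U)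
    {P : Set ℂ} (hPcd : ∀ z₀ : ℂ, ∀ᶠ s in 𝓝[≠] z₀, s ∉ P) {z₁ : ℂ} (hz₁ : 1 / 2 < z₁.re ∧ 0 < z₁.im) (hz₁b : z₁ ∈ Metric.ball (0 : ℂ) (n + 2)) :
    ∀ᶠ z in 𝓝[≠] z₁, z ∈ ({z : ℂ | 1 / 2 < z.re ∧ 0 < z.im} ∩ Metric.ball (0 : ℂ) (n + 2) ∩ U) \ P := by
  have hQo : IsOpen ({z : ℂ | 1 / 2 < z.re ∧ 0 < z.im} ∩ Metric.ball (0 : ℂ) (n + 2)) :=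
    ((isOpen_lt continuous_const Complex.continuous_re).inter (isOpen_lt continuous_const Complex.continuous_im)).inter Metric.isOpen_ball
  filter_upwards [mem_nhdsWithin_of_mem_nhds (hQo.mem_nhds ⟨hz₁, hz₁b⟩), hUcod z₁ hz₁b, hPcd z₁] with z hzC hzU hzP
  exact ⟨⟨hzC, hzU⟩, hzP⟩

/-- **Every `z₁` lies in the ball `D_n` for `n = max 2 ⌈‖z₁‖⌉₊`.** [folklore] -/
theorem mem_ball_max_ceil (z₁ : ℂ) : z₁ ∈ Metric.ball (0 : ℂ) ((max 2 ⌈‖z₁‖⌉₊ : ℕ) + 2) := by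
  rw [mem_ball_zero_iff]
  have h1 : ‖z₁‖ ≤ (⌈‖z₁‖⌉₊ : ℝ) := Nat.le_ceil _
  have h2 : ((⌈‖z₁‖⌉₊ : ℕ) : ℝ) ≤ ((max 2 ⌈‖z₁‖⌉₊ : ℕ) : ℝ) := by exact_mod_cast le_max_right _ _
  linarith

end Balls

/-! ## §4 Per-ball letters (one `variable` block, VERBATIM the shapes above) and the heads: no pole in `D⁺`, no complex pole, `hreal`, `hs` -/

section Heads

/- THE LETTERS (shared by the four heads below, in this order): the closed co-discrete pole set `P`; the coordinates `qc_j` (normal-form meromorphic on `ℂ`, analytic off `P` — ★ M1 print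
(E2)(E4)); a linearly independent finite family `e_j ∈ V`, `r ≠ 0`, and the intertwined section `ψ` with `ψ z = r • Σ_j qc_j(z) • e_j` off `P`; `κ, m > 0`, `φ ≠ 0`; per ball `n`: the open
`U n`, co-discrete in `ball 0 (n+2)`, and on `D₁(n) = ({½ < Re, 0 < Im} ∩ ball 0 (n+2) ∩ U n) ∖ P` (for `2 ≤ n`) the model family `F n` holomorphic with the SELF-DUAL relation `hrel` (base
`T n ≥ 1`, constants `cμ n, K n > 0`) — the `hrel ∕ F ∕ hFd` bytes of ★ `poleControl_continued_chi_cm_two_of_family_selfDual_on` on the domain of ★ `exists_truncatedFamily_chi_cm_two_upper`. -/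
variable {V : Type*} [NormedAddCommGroup V] [InnerProductSpace ℂ V] {ι' : Type*} [Fintype ι']
  {P : Set ℂ} (hPc : IsClosed P) (hPcd : ∀ z₀ : ℂ, ∀ᶠ s in 𝓝[≠] z₀, s ∉ P)
  {qc : ι' → ℂ → ℂ} (hqNF : ∀ j, MeromorphicNFOn (qc j) univ) (hqa : ∀ j (z : ℂ), z ∉ P → AnalyticAt ℂ (qc j) z)
  {e : ι' → V} (he : LinearIndependent ℂ e) {r : ℂ} (hr : r ≠ 0) {ψ : ℂ → V} (hψ : ∀ z : ℂ, z ∉ P → ψ z = r • ∑ j, qc j z • e j)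
  {κ m : ℝ} (hκ : 0 < κ) (hm : 0 < m) {φ : V} (hφ : φ ≠ 0)
  (U : ℕ → Set ℂ) (hUo : ∀ n, IsOpen (U n)) (hUcod : ∀ n : ℕ, ∀ z₀ ∈ Metric.ball (0 : ℂ) (n + 2), ∀ᶠ s in 𝓝[≠] z₀, s ∈ U n)
  {T cμ K : ℕ → ℝ} (hT : ∀ n, 1 ≤ T n) (hcμ : ∀ n, 0 < cμ n) (hK : ∀ n, 0 < K n)
  {H : Type*} [NormedAddCommGroup H] [InnerProductSpace ℂ H] (F : ℕ → ℂ → H)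
  (hFd : ∀ n : ℕ, 2 ≤ n → DifferentiableOn ℂ (F n) (({z : ℂ | 1 / 2 < z.re ∧ 0 < z.im} ∩ Metric.ball (0 : ℂ) (n + 2) ∩ U n) \ P))
  (hrel : ∀ n : ℕ, 2 ≤ n → ∀ z ∈ ({z : ℂ | 1 / 2 < z.re ∧ 0 < z.im} ∩ Metric.ball (0 : ℂ) (n + 2) ∩ U n) \ P,
      ∀ z' ∈ ({z : ℂ | 1 / 2 < z.re ∧ 0 < z.im} ∩ Metric.ball (0 : ℂ) (n + 2) ∩ U n) \ P, 1 < z'.re → z'.re < z.re →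
      ⟪F n z', F n z⟫_ℂ = ((cμ n : ℝ) : ℂ) * (((K n : ℝ) : ℂ) *
        ((((T n : ℝ) : ℂ) ^ (z + conj z' - 1) / (z + conj z' - 1)) * (((κ : ℝ) : ℂ) * (((m : ℝ) : ℂ) * ⟪φ, φ⟫_ℂ))
          + (((T n : ℝ) : ℂ) ^ (z - conj z') / (z - conj z')) * (((κ : ℝ) : ℂ) * (((m : ℝ) : ℂ) * ⟪ψ z', φ⟫_ℂ))
          - (((T n : ℝ) : ℂ) ^ (-(z - conj z')) / (z - conj z')) * (((κ : ℝ) : ℂ) * (((m : ℝ) : ℂ) * ⟪φ, ψ z⟫_ℂ))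
          - (((T n : ℝ) : ℂ) ^ (-(z + conj z' - 1)) / (z + conj z' - 1)) * (((κ : ℝ) : ℂ) * (((m : ℝ) : ℂ) * ⟪ψ z', ψ z⟫_ℂ)))))

include hPc hPcd hqNF hqa he hr hψ hκ hm hφ hUo hUcod hT hcμ hK hFd hrel

/-- **NO POLE IN THE OPEN UPPER QUADRANT `D⁺` FOR THE SCATTERING COORDINATES, FROM THE PER-BALL SELF-DUAL MODEL DATA** (letters: the `variable` block above).  `qc_j` is analytic at every
`z₁` with `½ < Re z₁`, `0 < Im z₁`: §2 on the ball `n = max 2 ⌈‖z₁‖⌉₊` with the topology of §3 and the domination of §1 (`ψ` is holomorphic off `P` by `hψ`).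
[cite: MoeglinWaldspurger1995, IV.1.9, IV.1.11, IV.3.12 (a)] [cite: BernsteinLapid2019, Thm 2.3, §4] -/
theorem analyticAt_coords_of_family_selfDual_balls : ∀ j (z₁ : ℂ), 1 / 2 < z₁.re → 0 < z₁.im → AnalyticAt ℂ (qc j) z₁ := by
  classical
  intro j z₁ hz₁re hz₁im
  -- the ball
  set n : ℕ := max 2 ⌈‖z₁‖⌉₊ with hndef
  have hn : 2 ≤ n := le_max_left _ _
  have hz₁b : z₁ ∈ Metric.ball (0 : ℂ) (n + 2) := mem_ball_max_ceil z₁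
  -- topology of `D₁(n)` and the punctured neighbourhood
  have hPcount : P.Countable := countable_of_codiscreteWithin fun x _ => hPcd x
  obtain ⟨hD₁o, hD₁c, hD₁sub, O₁, O₂', hO₁o, hO₁ne, hO₁D, hO₂o, hO₂ne, hO₂D, hsep⟩ := upperBallDomain_topology n hn (hUo n) (hUcod n) hPc hPcount
  have hev := eventually_mem_upperBallDomain n (hUcod n) hPcd ⟨hz₁re, hz₁im⟩ hz₁b
  -- `ψ` is holomorphic off `P`, hence on `D₁(n)`
  have hψd : DifferentiableOn ℂ ψ (({z : ℂ | 1 / 2 < z.re ∧ 0 < z.im} ∩ Metric.ball (0 : ℂ) (n + 2) ∩ U n) \ P) := by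
    have hsum : DifferentiableOn ℂ (fun z : ℂ => r • ∑ i, qc i z • e i) (({z : ℂ | 1 / 2 < z.re ∧ 0 < z.im} ∩ Metric.ball (0 : ℂ) (n + 2) ∩ U n) \ P) :=
      (DifferentiableOn.fun_sum fun i _ => (fun z hz => ((hqa i z hz.2).differentiableAt.differentiableWithinAt).smul_const (e i))).const_smul r
    exact hsum.congr fun z hz => hψ z hz.2
  -- domination of the coordinate `qc j` by `ψ`
  obtain ⟨C, -, hC⟩ := exists_norm_apply_le_norm_sum_smul he
  have hdom : ∀ z ∈ ({z : ℂ | 1 / 2 < z.re ∧ 0 < z.im} ∩ Metric.ball (0 : ℂ) (n + 2) ∩ U n) \ P, ‖qc j z‖ ≤ C / ‖r‖ * ‖ψ z‖ := by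
    intro z hz
    have hrn : 0 < ‖r‖ := norm_pos_iff.2 hr
    have h1 := hC (fun i => qc i z) j
    have h2 : ‖ψ z‖ = ‖r‖ * ‖∑ i, qc i z • e i‖ := by rw [hψ z hz.2, norm_smul]
    rw [h2, div_mul_eq_mul_div, mul_left_comm, mul_div_cancel_left₀ _ hrn.ne']
    exact h1
  exact analyticAt_of_family_selfDual_on' hD₁o hD₁c hD₁sub hO₁o hO₁ne hO₁D hO₂o hO₂ne hO₂D hsep (hT n) (hcμ n) (hK n) hκ hm hφ hψd (F n) (hFd n hn) (hrel n hn)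
    hdom (hqNF j (mem_univ z₁)) ⟨hz₁re, hz₁im⟩ hev

/-- **NO POLE OFF THE REAL AXIS IN `½ < Re z` — BOTH HALF-PLANES** for the scattering coordinates of a SELF-DUAL datum: the `variable` letters plus the reflection symmetry
`qc_j(conj z) = conj qc_j(z)` off `P ∪ conj P` (★ p860445 `chi_scattering_conj_symm_m1_cm_two` at M1).  Upper half-plane `analyticAt_coords_of_family_selfDual_balls`; lower half-plane by
reflection (§1 `analyticAt_of_eventuallyEq_conj`). [cite: MoeglinWaldspurger1995, IV.3.12 (a)] [cite: Langlands1976, §7] -/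
theorem chi_scattering_noComplexPole_m1_cm_two (hconj : ∀ j (z : ℂ), z ∉ P → conj z ∉ P → qc j (conj z) = conj (qc j z)) :
    ∀ j (z₁ : ℂ), 1 / 2 < z₁.re → z₁.im ≠ 0 → AnalyticAt ℂ (qc j) z₁ := by
  have hup := analyticAt_coords_of_family_selfDual_balls hPc hPcd hqNF hqa he hr hψ hκ hm hφ U hUo hUcod hT hcμ hK F hFd hrel
  intro j z₁ hz₁re hz₁im
  rcases lt_or_gt_of_ne hz₁im with hneg | hpos
  · -- lower half-plane: reflect
    have hc : AnalyticAt ℂ (qc j) (conj z₁) := hup j (conj z₁) (by rwa [Complex.conj_re]) (by rw [Complex.conj_im]; linarith)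
    exact analyticAt_of_eventuallyEq_conj (hqNF j (mem_univ z₁)) hc (eventually_eq_conj_of_poleSet hPcd (hconj j) z₁)
  · exact hup j z₁ hz₁re hpos

/-- **THE (d)-REALNESS LETTER `hreal` AT M1** — VERBATIM the binder of ★ `exists_finset_differentiableOn_halfStrip_of_fe_of_conj` ∕ ★ `exists_finset_differentiableOn_strip_of_singular`, for
every `σ₀ > 1` and every coordinate `j`, given also `P ⊆ {Re ≤ 1}` (★ M1 print (E3)) and the reflection symmetry: a NON-ANALYTIC point of `qc_j` with `½ < Re z ≤ σ₀` is REAL with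
`Re z < σ₀` (off the axis by `chi_scattering_noComplexPole_m1_cm_two`; a non-analytic point lies in `P ⊆ {Re ≤ 1}`). [cite: MoeglinWaldspurger1995, IV.1.11, IV.3.12 (a)] [cite: Langlands1976, §7] -/
theorem chi_scattering_hreal_m1_cm_two (hPre : ∀ z ∈ P, z.re ≤ 1) (hconj : ∀ j (z : ℂ), z ∉ P → conj z ∉ P → qc j (conj z) = conj (qc j z)) {σ₀ : ℝ} (hσ₀ : 1 < σ₀) :
    ∀ j (z : ℂ), ¬ AnalyticAt ℂ (qc j) z → 1 / 2 < z.re → z.re ≤ σ₀ → z.im = 0 ∧ z.re < σ₀ := by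
  have hnc := chi_scattering_noComplexPole_m1_cm_two hPc hPcd hqNF hqa he hr hψ hκ hm hφ U hUo hUcod hT hcμ hK F hFd hrel hconj
  intro j z hz hzre _
  have hzP : z ∈ P := by
    by_contra h
    exact hz (hqa j z h)
  refine ⟨?_, lt_of_le_of_lt (hPre z hzP) hσ₀⟩
  by_contra him
  exact hz (hnc j z hzre him)

/-- **`hreal` AND THE ENTRY LETTER `hs` AT M1** — given also the self-dual functional equation (FE) `qc_j(z)·qc_j(1 − z) = 1` off `P ∪ (1 − P)` (★ C3 `chi_scattering_fe_cm_two`, `χʷ = χ`):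
for every `σ₀ > 1` and every `j`, `hreal` and a finset `S ⊂ (½, σ₀)` of genuine real poles with an open `U' ⊇ {½ ≤ Re ≤ σ₀}` on which `qc_j` is holomorphic off `S` (★ p860392 §4, the axis
pole-free by ★ p860080) — the `hs` letter of ★ `exists_linearIsometry_selfDual_of_letters` for the entry `qc_j`. [cite: MoeglinWaldspurger1995, IV.1.11, IV.3.12 (a)] [cite: Langlands1976, §7] -/
theorem chi_scattering_hs_m1_cm_two (hPre : ∀ z ∈ P, z.re ≤ 1) (hFE : ∀ j (z : ℂ), z ∉ P → 1 - z ∉ P → qc j z * qc j (1 - z) = 1)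
    (hconj : ∀ j (z : ℂ), z ∉ P → conj z ∉ P → qc j (conj z) = conj (qc j z)) {σ₀ : ℝ} (hσ₀ : 1 < σ₀) (j : ι') :
    (∀ z : ℂ, ¬ AnalyticAt ℂ (qc j) z → 1 / 2 < z.re → z.re ≤ σ₀ → z.im = 0 ∧ z.re < σ₀) ∧
      ∃ (S : Finset ℝ) (U' : Set ℂ), (∀ x ∈ S, ¬ AnalyticAt ℂ (qc j) (x : ℂ) ∧ 1 / 2 < x ∧ x < σ₀) ∧ IsOpen U' ∧ {z : ℂ | 1 / 2 ≤ z.re ∧ z.re ≤ σ₀} ⊆ U' ∧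
        DifferentiableOn ℂ (qc j) (U' \ ((S.image fun x : ℝ => (x : ℂ)) : Set ℂ)) := by
  have hreal := chi_scattering_hreal_m1_cm_two hPc hPcd hqNF hqa he hr hψ hκ hm hφ U hUo hUcod hT hcμ hK F hFd hrel hPre hconj hσ₀ j
  exact ⟨hreal, exists_finset_differentiableOn_halfStrip_of_fe_of_conj (hqNF j) hPcd (hqa j) (hFE j) (hconj j) hreal⟩

end Heads

end Summit.HodgeConjecture.HodgeConjecture.Cruxes.H413.K2E1ChiScatteringRealPolesM1CMTwo

end
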